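import Mathlib
import HarnessLib
import Literature.MathematicalPhysics.StatisticalMechanics.RelevantHamiltonianNormL2
import Literature.MathematicalPhysics.StatisticalMechanics.TaylorPolynomialNormsExpectation
import Literature.MathematicalPhysics.StatisticalMechanics.WeightedNormBounds
import Literature.MathematicalPhysics.StatisticalMechanics.RelevantHamiltonianDerivatives

/-!
# The exponential map `E(H) = e^{H}` into the strong norm ([ABKM19] Lemma 9.3, first-order form):
# `|e^{±H(B)}|_{T_φ} ≤ e^{1/4} W(φ)` and `|e^{H(B)} − 1|_{T_φ} ≤ 8e^{1/4} ‖H‖_{k,0} W(φ)` for `‖H‖_{k,0} ≤ ⅛`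

[ABKM19] Lemma 9.3: the map `E : (M_0, ‖·‖_{k,0}) → (M(𝓑_k), |||·|||_k)`, `E(H)(B) = e^{H(B)}`, is smooth
on the ball `‖H‖_{k,0} ≤ 1/8` with `|||e^H − 1|||_k ≤ 8‖H‖_{k,0}`, where the strong norm uses the
weight `W_k^B(φ) = e^{½(φ, G_k^B φ)}` and `(φ, G_k^B φ) ≥ |φ|²_{k,ℓ²(B)}`.  Ingredients: Lemma 8.8 in
`ℓ²` form (`tayNorm_eval_le_of_ell2`), `‖e^F‖_{T_φ} ≤ e^{‖F‖_{T_φ}}` (`tayNorm_cexp_le_exp`) and the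
new `‖e^F − 1‖_{T_φ} ≤ ‖F‖_{T_φ} e^{‖F‖_{T_φ}}`.  We state the result for an ABSTRACT weight `W`
dominating the `ℓ²` level: `e^{N(φ)²/2} ≤ W(φ)` where `N(φ)` dominates the normalised `ℓ²(B)` norms of
`∇^αφ` (for the [ABKM19] strong weight, `N² = (φ, G_k^B φ)`; the instantiation is a separate step).

* `tphiSeminorm_cexp_sub_one_le`, **`tayNorm_cexp_sub_one_le`** — `‖e^F − 1‖_{T_φ} ≤ ‖F‖_{T_φ}e^{‖F‖_{T_φ}}`;
* `Ell2Dominates` — the domination hypothesis on `(B, 𝔥, R, W)`;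
* **`tayNormLE_cexp_eval`**, **`tayNormLE_cexp_neg_eval`** — `‖e^{±H(B)}‖_{T,W} ≤ e^{1/4}`;
* **`tayNormLE_cexp_eval_sub_one`** — `‖e^{H(B)} − 1‖_{T,W} ≤ 8 e^{1/4} ‖H‖_{k,0}`.

Everything is proved; no named fact.

## References
* S. Adams, S. Buchholz, R. Kotecký, S. Müller, arXiv:1910.13564, Lemma 9.3 ((9.13)–(9.16)),
  Lemma 8.8 [AdamsBuchholzKoteckyMuller2019].
* R. Bauerschmidt, D. Brydges, G. Slade, LNM 2242 (2019), Lemma 7.4.1 [BauerschmidtBrydgesSlade2019RG].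
-/

noncomputable section

/-! ## `‖e^F − 1‖_{T_φ} ≤ ‖F‖_{T_φ} e^{‖F‖_{T_φ}}` -/

namespace Literature.MathematicalPhysics.QuantumFieldTheory

open Finset

variable {E : Type*} [NormedAddCommGroup E] [NormedSpace ℝ E]

/-- **`‖e^F − 1‖_{T_φ(𝔥)} ≤ ‖F‖_{T_φ(𝔥)} · e^{‖F‖_{T_φ(𝔥)}}`** for complex `F` of class `C^N`: the order-0
term is `|e^{F(φ)} − 1| ≤ |F(φ)|e^{|F(φ)|}`, the higher orders are those of `e^F`, bounded by
`e^{Re F(φ)}(e^{‖F‖_{T_φ} − |F(φ)|} − 1) ≤ e^{‖F‖_{T_φ}} − e^{|F(φ)|} ≤ (‖F‖_{T_φ} − |F(φ)|) e^{‖F‖_{T_φ}}`.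
[cite: BauerschmidtBrydgesSlade2019RG, Lemma 7.4.1] -/
theorem tphiSeminorm_cexp_sub_one_le (N : ℕ) {𝔥 : ℝ} (h𝔥 : 0 ≤ 𝔥) {F : E → ℂ} (hF : ContDiff ℝ N F)
    (φ : E) :
    tphiSeminorm N 𝔥 (fun x => Complex.exp (F x) - 1) φ ≤
      tphiSeminorm N 𝔥 F φ * Real.exp (tphiSeminorm N 𝔥 F φ) := by
  set a := tphiSeminorm N 𝔥 F φ with ha
  set z := F φ with hz
  have hza : ‖z‖ ≤ a := norm_le_tphiSeminorm N h𝔥 F φ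
  have hz0 : 0 ≤ ‖z‖ := norm_nonneg _
  have hG : ContDiff ℝ N (fun x => Complex.exp (F x)) := hF.cexp
  -- higher derivatives of `e^F − 1` are those of `e^F`
  have hderiv : ∀ p : ℕ, p < N → iteratedFDeriv ℝ (p + 1) (fun x => Complex.exp (F x) - 1) φ =
      iteratedFDeriv ℝ (p + 1) (fun x => Complex.exp (F x)) φ := by
    intro p hp
    have h1 : (fun x => Complex.exp (F x) - 1) = (fun x => Complex.exp (F x)) + fun _ => (-1 : ℂ) := by
      funext x; simp [sub_eq_add_neg]
    have hp' : ((p + 1 : ℕ) : WithTop ℕ∞) ≤ N := by exact_mod_cast hp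
    rw [h1, iteratedFDeriv_add_apply (hG.contDiffAt.of_le hp') contDiffAt_const,
      iteratedFDeriv_const_of_ne (by omega), Pi.zero_apply, add_zero]
  -- the order-0 term
  have h0 : ‖Complex.exp z - 1‖ ≤ ‖z‖ * Real.exp ‖z‖ := by
    have h := Complex.norm_exp_sub_sum_le_norm_mul_exp z 1
    simpa using h
  -- the higher orders
  have hS : ∑ p ∈ range N, 𝔥 ^ (p + 1) / ((p + 1).factorial : ℝ) *
      ‖iteratedFDeriv ℝ (p + 1) (fun x => Complex.exp (F x) - 1) φ‖ =
      tphiSeminorm N 𝔥 (fun x => Complex.exp (F x)) φ - ‖Complex.exp z‖ := by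
    rw [tphiSeminorm_eq_norm_add N 𝔥 (fun x => Complex.exp (F x)) φ, ← hz, add_sub_cancel_left]
    exact sum_congr rfl fun p hp => by rw [hderiv p (mem_range.1 hp)]
  have hexp : tphiSeminorm N 𝔥 (fun x => Complex.exp (F x)) φ ≤
      Real.exp z.re * Real.exp (a - ‖z‖) := tphiSeminorm_cexp_le N h𝔥 hF φ
  have hre : Real.exp z.re ≤ Real.exp ‖z‖ := Real.exp_le_exp.2 (Complex.re_le_norm z)
  have hnz : ‖Complex.exp z‖ = Real.exp z.re := Complex.norm_exp z
  have h1le : 1 ≤ Real.exp (a - ‖z‖) := Real.one_le_exp (by linarith)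
  -- `e^a − e^{|z|} ≤ (a − |z|) e^a`
  have hmvt : Real.exp a - Real.exp ‖z‖ ≤ (a - ‖z‖) * Real.exp a := by
    have h := Real.add_one_le_exp (‖z‖ - a)
    have hea : 0 < Real.exp a := Real.exp_pos a
    have : Real.exp (‖z‖ - a) * Real.exp a = Real.exp ‖z‖ := by rw [← Real.exp_add]; ring_nf
    nlinarith
  rw [tphiSeminorm_eq_norm_add, hS, hnz]
  calc ‖Complex.exp z - 1‖ + (tphiSeminorm N 𝔥 (fun x => Complex.exp (F x)) φ - Real.exp z.re)
      ≤ ‖z‖ * Real.exp ‖z‖ + (Real.exp z.re * Real.exp (a - ‖z‖) - Real.exp z.re) := by linarith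
    _ = ‖z‖ * Real.exp ‖z‖ + Real.exp z.re * (Real.exp (a - ‖z‖) - 1) := by ring
    _ ≤ ‖z‖ * Real.exp ‖z‖ + Real.exp ‖z‖ * (Real.exp (a - ‖z‖) - 1) := by
        gcongr
    _ = ‖z‖ * Real.exp ‖z‖ + (Real.exp a - Real.exp ‖z‖) := by
        rw [mul_sub, ← Real.exp_add, mul_one]; ring_nf
    _ ≤ ‖z‖ * Real.exp a + (a - ‖z‖) * Real.exp a := by
        gcongr
    _ = a * Real.exp a := by ring

end Literature.MathematicalPhysics.QuantumFieldTheory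

namespace Literature.MathematicalPhysics.StatisticalMechanics.GradientRG

open scoped BigOperators
open Finset
open Literature.MathematicalPhysics.QuantumFieldTheory
open Literature.MathematicalPhysics.StatisticalMechanics.GradientFRD (iterDiff fwdDiff)

section Generic

variable {E V : Type*} [NormedAddCommGroup E] [NormedSpace ℝ E] [FiniteDimensional ℝ E]
  [NormedAddCommGroup V] [NormedSpace ℝ V]

/-- **`‖e^F − 1‖_{T_φ} ≤ ‖F‖_{T_φ} e^{‖F‖_{T_φ}}`** relative to any gauge (complex `C^{r₀}` functional `F`).
[cite: AdamsBuchholzKoteckyMuller2019, Lemma 9.3 (9.16)] -/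
theorem tayNorm_cexp_sub_one_le (T : E →ₗ[ℝ] V) {r₀ : ℕ} {F : E → ℂ} (hF : ContDiff ℝ r₀ F) (φ : E) :
    tayNorm T r₀ (fun ψ => Complex.exp (F ψ) - 1) φ ≤
      tayNorm T r₀ F φ * Real.exp (tayNorm T r₀ F φ) := by
  rw [tayNorm_eq_tphiSeminorm, tayNorm_eq_tphiSeminorm]
  exact tphiSeminorm_cexp_sub_one_le r₀ zero_le_one (contDiff_gaugeLift T hF) _

end Generic

/-! ## Lemma 9.3 for an abstract `ℓ²`-dominating weight -/

variable {𝕜 : Type*} {d M : ℕ} [NeZero M]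

/-- **The weight `W` dominates the `ℓ²(B)` level of the field** (relative to the coefficient-norm
parameters `𝔥, R`): for every `φ` there is `N ≥ 0` with `‖∇^αφ‖_{ℓ²(B)} ≤ N√|B|·𝔥R^{−|α|}`
(`α ∈ linIndex d`), `‖∇_iφ‖_{ℓ²(B)} ≤ N√|B|·𝔥/R`, and `e^{N²/2} ≤ W(φ)` — for the strong weight of
[ABKM19], `N² = |φ|²_{k,ℓ²(B)} ≤ (φ, G_k^B φ)` and `W_k^B = e^{½(φ, G_k^Bφ)}`.
[cite: AdamsBuchholzKoteckyMuller2019, Ch. 9.2 (9.14)–(9.15)] -/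
def Ell2Dominates (B : Finset (Fin d → ZMod M)) (𝔥 R : ℝ) (W : ((Fin d → ZMod M) → ℝ) → ℝ) : Prop :=
  ∀ φ : (Fin d → ZMod M) → ℝ, ∃ N : ℝ, 0 ≤ N ∧
    (∀ α : linIndex d, Real.sqrt (∑ x ∈ B, (iterDiff (α : Fin d → ℕ) φ x) ^ 2) ≤
      N * (Real.sqrt B.card * (𝔥 * (R ^ (∑ i, (α : Fin d → ℕ) i))⁻¹))) ∧
    (∀ i : Fin d, Real.sqrt (∑ x ∈ B, (fwdDiff i φ x) ^ 2) ≤ N * (Real.sqrt B.card * (𝔥 / R))) ∧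
    Real.exp (N ^ 2 / 2) ≤ W φ

variable [NormedField 𝕜] [NormedAlgebra ℝ 𝕜] [NormOneClass 𝕜]

/-- `|H(B)|_{T_φ} ≤ (1 + N²)·2‖H‖_{k,0}` (from `(1+N)² ≤ 2(1+N²)`).
[cite: AdamsBuchholzKoteckyMuller2019, Lemma 9.3 (9.15)] -/
theorem tayNorm_eval_le_quarter {𝔥 R : ℝ} (h𝔥 : 0 < 𝔥) (hR : 0 < R) {p : ℕ} (hp : d / 2 + 1 ≤ p)
    {S B : Finset (Fin d → ZMod M)} (hBS : B ⊆ S) {H : RelevantHamiltonian 𝕜 d} {r₀ : ℕ}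
    {φ : (Fin d → ZMod M) → ℝ} {N : ℝ} (hN0 : 0 ≤ N)
    (hNlin : ∀ α : linIndex d, Real.sqrt (∑ x ∈ B, (iterDiff (α : Fin d → ℕ) φ x) ^ 2) ≤
      N * (Real.sqrt B.card * (𝔥 * (R ^ (∑ i, (α : Fin d → ℕ) i))⁻¹)))
    (hNgrad : ∀ i : Fin d, Real.sqrt (∑ x ∈ B, (fwdDiff i φ x) ^ 2) ≤ N * (Real.sqrt B.card * (𝔥 / R))) :
    tayNorm (fieldGauge 𝔥 R p S) r₀ (fun ψ : (Fin d → ZMod M) → ℝ => eval H B ψ) φ ≤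
      (1 + N ^ 2) * (2 * hamNorm 𝔥 R B.card H) := by
  have h := tayNorm_eval_le_of_ell2 (𝕜 := 𝕜) h𝔥 hR hp hBS H r₀ φ hN0 hNlin hNgrad
  have hH0 : 0 ≤ hamNorm 𝔥 R B.card H := hamNorm_nonneg h𝔥.le hR.le _ _
  have hsq : (1 + N) ^ 2 ≤ 2 * (1 + N ^ 2) := by nlinarith [sq_nonneg (1 - N)]
  calc _ ≤ (1 + N) ^ 2 * hamNorm 𝔥 R B.card H := h
    _ ≤ 2 * (1 + N ^ 2) * hamNorm 𝔥 R B.card H := mul_le_mul_of_nonneg_right hsq hH0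
    _ = (1 + N ^ 2) * (2 * hamNorm 𝔥 R B.card H) := by ring

/-- **`‖e^{H(B)}‖_{T, W} ≤ e^{1/4}` for `‖H‖_{k,0} ≤ ⅛`** and an `ℓ²`-dominating weight `W`
([ABKM19] Lemma 9.3: `|||E(H)|||_k` bounded on the ball of radius `1/8`).
[cite: AdamsBuchholzKoteckyMuller2019, Lemma 9.3 (9.15)] -/
theorem tayNormLE_cexp_eval {𝔥 R : ℝ} (h𝔥 : 0 < 𝔥) (hR : 0 < R) {p : ℕ} (hp : d / 2 + 1 ≤ p)
    {S B : Finset (Fin d → ZMod M)} (hBS : B ⊆ S) {W : ((Fin d → ZMod M) → ℝ) → ℝ}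
    (hW : Ell2Dominates B 𝔥 R W) {H : RelevantHamiltonian ℂ d} (r₀ : ℕ)
    (hH : hamNorm 𝔥 R B.card H ≤ 1 / 8) :
    TayNormLE (fieldGauge 𝔥 R p S) r₀ W (fun ψ : (Fin d → ZMod M) → ℝ => Complex.exp (eval H B ψ))
      (Real.exp (1 / 4)) := by
  intro φ
  obtain ⟨N, hN0, hNlin, hNgrad, hNW⟩ := hW φ
  have hH0 : 0 ≤ hamNorm 𝔥 R B.card H := hamNorm_nonneg h𝔥.le hR.le _ _
  have h1 := tayNorm_eval_le_quarter (𝕜 := ℂ) h𝔥 hR hp hBS (H := H) (r₀ := r₀) hN0 hNlin hNgrad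
  have h2 := tayNorm_cexp_le_exp (fieldGauge 𝔥 R p S) (contDiff_eval H B (n := r₀)) φ
  refine h2.trans ?_
  have h3 : tayNorm (fieldGauge 𝔥 R p S) r₀ (fun ψ : (Fin d → ZMod M) → ℝ => eval H B ψ) φ ≤
      1 / 4 + N ^ 2 / 4 := by
    have : (1 + N ^ 2) * (2 * hamNorm 𝔥 R B.card H) ≤ (1 + N ^ 2) * (2 * (1 / 8)) :=
      mul_le_mul_of_nonneg_left (by linarith) (by positivity)
    linarith
  calc Real.exp (tayNorm (fieldGauge 𝔥 R p S) r₀ (fun ψ => eval H B ψ) φ)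
      ≤ Real.exp (1 / 4 + N ^ 2 / 4) := Real.exp_le_exp.2 h3
    _ = Real.exp (1 / 4) * Real.exp (N ^ 2 / 4) := by rw [Real.exp_add]
    _ ≤ Real.exp (1 / 4) * Real.exp (N ^ 2 / 2) := by
        gcongr; linarith [sq_nonneg N]
    _ ≤ Real.exp (1 / 4) * W φ := mul_le_mul_of_nonneg_left hNW (Real.exp_pos _).le

/-- **`‖e^{−H(B)}‖_{T, W} ≤ e^{1/4}` for `‖H‖_{k,0} ≤ ⅛`** (`‖−H‖_{k,0} = ‖H‖_{k,0}`): the Boltzmann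
factor `expNegH H B`. [cite: AdamsBuchholzKoteckyMuller2019, Lemma 9.3 (9.15)] -/
theorem tayNormLE_cexp_neg_eval {𝔥 R : ℝ} (h𝔥 : 0 < 𝔥) (hR : 0 < R) {p : ℕ} (hp : d / 2 + 1 ≤ p)
    {S B : Finset (Fin d → ZMod M)} (hBS : B ⊆ S) {W : ((Fin d → ZMod M) → ℝ) → ℝ}
    (hW : Ell2Dominates B 𝔥 R W) {H : RelevantHamiltonian ℂ d} (r₀ : ℕ)
    (hH : hamNorm 𝔥 R B.card H ≤ 1 / 8) :
    TayNormLE (fieldGauge 𝔥 R p S) r₀ W (fun ψ : (Fin d → ZMod M) → ℝ => Complex.exp (-(eval H B ψ)))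
      (Real.exp (1 / 4)) := by
  have hneg : (fun ψ : (Fin d → ZMod M) → ℝ => Complex.exp (-(eval H B ψ))) =
      fun ψ => Complex.exp (eval (-H) B ψ) := by
    funext ψ
    have : eval (-H) B ψ = -(eval H B ψ) := by
      have h := eval_add H (-H) B ψ
      rw [add_neg_cancel, eval_zero] at h
      exact eq_neg_of_add_eq_zero_right h.symm
    rw [this]
  rw [hneg]
  have hH' : hamNorm 𝔥 R B.card (-H) ≤ 1 / 8 := by
    have : hamNorm 𝔥 R B.card (-H) = hamNorm 𝔥 R B.card H := by
      unfold hamNorm; simp only [Pi.neg_apply, norm_neg]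
    rw [this]; exact hH
  exact tayNormLE_cexp_eval h𝔥 hR hp hBS hW r₀ hH'

/-- **`‖e^{H(B)} − 1‖_{T, W} ≤ 8e^{1/4} ‖H‖_{k,0}` for `‖H‖_{k,0} ≤ ⅛`** ([ABKM19] (9.16), with the
constant `8e^{1/4}` in place of `8`). [cite: AdamsBuchholzKoteckyMuller2019, Lemma 9.3 (9.16)] -/
theorem tayNormLE_cexp_eval_sub_one {𝔥 R : ℝ} (h𝔥 : 0 < 𝔥) (hR : 0 < R) {p : ℕ} (hp : d / 2 + 1 ≤ p)
    {S B : Finset (Fin d → ZMod M)} (hBS : B ⊆ S) {W : ((Fin d → ZMod M) → ℝ) → ℝ}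
    (hW : Ell2Dominates B 𝔥 R W) {H : RelevantHamiltonian ℂ d} (r₀ : ℕ)
    (hH : hamNorm 𝔥 R B.card H ≤ 1 / 8) :
    TayNormLE (fieldGauge 𝔥 R p S) r₀ W (fun ψ : (Fin d → ZMod M) → ℝ => Complex.exp (eval H B ψ) - 1)
      (8 * Real.exp (1 / 4) * hamNorm 𝔥 R B.card H) := by
  intro φ
  obtain ⟨N, hN0, hNlin, hNgrad, hNW⟩ := hW φ
  set nH := hamNorm 𝔥 R B.card H with hnH
  have hH0 : 0 ≤ nH := hamNorm_nonneg h𝔥.le hR.le _ _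
  set t := tayNorm (fieldGauge 𝔥 R p S) r₀ (fun ψ : (Fin d → ZMod M) → ℝ => eval H B ψ) φ with ht
  have ht0 : 0 ≤ t := tayNorm_nonneg _ _ _ _
  have h1 : t ≤ (1 + N ^ 2) * (2 * nH) :=
    tayNorm_eval_le_quarter (𝕜 := ℂ) h𝔥 hR hp hBS (H := H) (r₀ := r₀) hN0 hNlin hNgrad
  have h2 := tayNorm_cexp_sub_one_le (fieldGauge 𝔥 R p S) (contDiff_eval H B (n := r₀)) φ
  refine h2.trans ?_
  rw [← ht]
  have ht4 : t ≤ 1 / 4 + N ^ 2 / 4 := by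
    have : (1 + N ^ 2) * (2 * nH) ≤ (1 + N ^ 2) * (2 * (1 / 8)) :=
      mul_le_mul_of_nonneg_left (by linarith) (by positivity)
    linarith
  -- `(1 + N²) ≤ 4 e^{N²/4}` and `e^{t} ≤ e^{1/4} e^{N²/4}`
  have hq : 1 + N ^ 2 ≤ 4 * Real.exp (N ^ 2 / 4) := by
    have := Real.add_one_le_exp (N ^ 2 / 4)
    linarith
  have hexp : Real.exp t ≤ Real.exp (1 / 4) * Real.exp (N ^ 2 / 4) := by
    rw [← Real.exp_add]; exact Real.exp_le_exp.2 ht4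
  have hsq : Real.exp (N ^ 2 / 4) * Real.exp (N ^ 2 / 4) = Real.exp (N ^ 2 / 2) := by
    rw [← Real.exp_add]; ring_nf
  calc t * Real.exp t ≤ ((1 + N ^ 2) * (2 * nH)) * (Real.exp (1 / 4) * Real.exp (N ^ 2 / 4)) :=
        mul_le_mul h1 hexp (Real.exp_pos _).le (by positivity)
    _ ≤ (4 * Real.exp (N ^ 2 / 4) * (2 * nH)) * (Real.exp (1 / 4) * Real.exp (N ^ 2 / 4)) := by
        gcongr
    _ = 8 * Real.exp (1 / 4) * nH * (Real.exp (N ^ 2 / 4) * Real.exp (N ^ 2 / 4)) := by ring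
    _ = 8 * Real.exp (1 / 4) * nH * Real.exp (N ^ 2 / 2) := by rw [hsq]
    _ ≤ 8 * Real.exp (1 / 4) * nH * W φ := mul_le_mul_of_nonneg_left hNW (by positivity)

end Literature.MathematicalPhysics.StatisticalMechanics.GradientRG


end
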